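import Summits.ResolutionOfSingularities.ResolutionOfSingularities.Theorems.EquisingularLiftEquisingularLiftNatPhaseBFinish
import Literature.AlgebraicGeometry.Resolution.FiniteQuotientSingularityPresentation
import Mathlib.RingTheory.RegularLocalRing.Polynomial
import HarnessLib

/-!
# [OURS · L1 W4.5(b) · EL♮(3)] ORDINARY-NOSE CHARTS II — the PINCH model `{x² = zy²}`: the chart `x̄` of its blow-up along the double
# line `(x̄, ȳ)` is the localised plane `Spec k[x, s, s⁻¹]` (THEOREM A (2.7); crux `EquisingularLiftNatThree` =
# stmt-ResolutionOfSingularities-20148; node 15660).  Part I (the A₁ model) = `…NatOrdinaryNoseA1Chart`.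

HONEST FRAMING. OURS (cell res-hironaka, crux chain w45b, slot W4.5(b)); NOT a statement of any manuscript; replaces the role of NOTHING
in the manuscript; AI-written, AI review is weaker than expert review; nothing of EL♮(3) is proved here. Helper
`--supports stmt-ResolutionOfSingularities-20148 --as helper`. Kernel twin of memo `L/res-L1-w45b-lead-1/EQUISINGULAR-NOSES.md`
(lead-1 g21, v1.1 c83fb69449b80442) §2, step (2.7): after the `t` sections at the triple points, THEOREM A's last move is ONE round
along the lifted double curve; downstairs it is the blow-up of the running 3-fold along the REDUCED double curve `Z^st`, and the strict
transform of an ordinary surface is regular because its two local models along `Z` resolve in one step: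

* the TRANSVERSAL A₁ model `𝒴₁ = Spec k[x,y,t]/(xy)` (two sheets crossing along `Z = V(x,y)`), chart `ȳ` of `Bl_{(x̄,ȳ)} 𝒴₁`:
  `B₁ = 𝒪_{𝒴₁}[(x̄,ȳ)/ȳ] ⊆ 𝒪_{𝒴₁}[1/ȳ]` — here `x̄ = 0` in `𝒪_{𝒴₁}[1/ȳ]` (`x̄·ȳ = 0`), so the fraction `x̄/ȳ` vanishes and
  **`ψ₁ : k[y,t] → B₁` is a bijection** (`A1Chart.ψ_bijective`): the chart is the sheet `{x = 0}`, an affine plane — regular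
  (`A1Chart.isRegularRing_B`); the chart `x̄` is the other sheet by symmetry;
* the PINCH (Whitney umbrella) model `𝒴₂ = Spec k[x,y,z]/(x² − zy²)`, chart `x̄` of `Bl_{(x̄,ȳ)} 𝒴₂`:
  `B₂ = 𝒪_{𝒴₂}[(x̄,ȳ)/x̄] ⊆ 𝒪_{𝒴₂}[1/x̄]` — with `s := ȳ/x̄` one has `z̄·s² = 1` (`x² = zy²` divided by `x²`), so `s` is a unit and
  **`ψ₂ : k[x,s][1/s] → B₂` is a bijection** (`PinchChart.ψ_bijective`), `z̄ = s⁻²`, `ȳ = x̄s`: the chart is the localised plane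
  `Spec k[x, s, s⁻¹]` — regular (`PinchChart.isRegularRing_B`, via `isRegularRing_localization`). The pinch chart `ȳ`
  (`k[x₁,y,z]/(x₁² − z) ≅ k[x₁,y]`) is, up to the renaming `(x, y, z) ↦ (y₃, y₁, −u)`, ✓ `PhaseBFinish.isRegularRing_B` (p565612) and
  is cited, not re-proved.

So on every chart the strict transform of an ordinary nose under the round along its reduced double curve is regular — the
computational content of THEOREM A (2.7) (the rest of Theorem A — flatness of `π_*𝒪_𝒮/𝒪_𝓗`, the conductor square, henselian
sheets — is by hand).  Proof pattern = the template ✓ `PhaseBFinish` (surjectivity from the graph relations and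
`blowupAlgebra.eval_surjective`; injectivity from an explicit left inverse after localisation).
Coordinates: A₁ model `X 0, X 1, X 2 = x, y, t`, model plane `X 0, X 1 = y, t`; pinch model `X 0, X 1, X 2 = x, y, z`, model
`X 0, X 1 = x, s` localised at `s`.

References: memo EQUISINGULAR-NOSES.md §2 (2.7); [StacksProject, Tags 052P/080E]; [GortzWedhorn2020, (13.19)].
-/

set_option linter.dupNamespace false -- mandated namespace `Summit.<Summit>.<Problem>` of this single-conjunct summit

noncomputable section

universe u

open Literature.AlgebraicGeometry.Resolution MvPolynomial

namespace Summit.ResolutionOfSingularities.ResolutionOfSingularities.Cruxes.EquisingularLiftNat.Sections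

/-! ## Part II — the pinch model `{x² = zy²}`, chart `x̄` -/

namespace PinchChart

/-- `c e = 1`, `c² = a v²` ⇒ `a (v e)² = 1`. [folklore] -/
theorem rel_unit {L : Type*} [CommRing L] (a c v e : L) (he : c * e = 1) (h : c ^ 2 = a * v ^ 2) :
    a * (v * e) ^ 2 = 1 := by
  calc a * (v * e) ^ 2 = a * v ^ 2 * e ^ 2 := by ring
    _ = c ^ 2 * e ^ 2 := by rw [h]
    _ = (c * e) ^ 2 := by ring
    _ = 1 := by rw [he, one_pow]

variable (k : Type u) [CommRing k]

/-- The equation `x² − z y²` of the pinch model (coordinates `X 0, X 1, X 2 = x, y, z`). OURS bookkeeping. -/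
def rel : MvPolynomial (Fin 3) k := X 0 ^ 2 - X 2 * X 1 ^ 2

/-- `𝒪_{𝒴₂} = k[x,y,z]/(x² − zy²)`. OURS bookkeeping. -/
abbrev OY : Type u := MvPolynomial (Fin 3) k ⧸ Ideal.span {rel k}

/-- `k[x,y,z] → 𝒪_{𝒴₂}`. OURS bookkeeping. -/
abbrev mkY : MvPolynomial (Fin 3) k →+* OY k := Ideal.Quotient.mk (Ideal.span {rel k})

/-- The trace `(x̄, ȳ)` of the round, chart element first. OURS bookkeeping. -/
def tr : Fin 2 → OY k := ![mkY k (X 0), mkY k (X 1)]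

/-- The chart `B₂ = 𝒪_{𝒴₂}[(x̄,ȳ)/x̄] ⊆ 𝒪_{𝒴₂}[1/x̄]`. OURS bookkeeping. -/
abbrev B : Subalgebra (OY k) (Localization.Away (tr k 0)) := blowupAlgebra (Ideal.span (Set.range (tr k))) (tr k 0)

/-- The model ring `k[x, s][1/s]`. OURS bookkeeping. -/
abbrev Model : Type u := Localization.Away (X 1 : MvPolynomial (Fin 2) k)

/-- The values of `x, s` in `B₂`: `x̄`, `ȳ/x̄`. OURS bookkeeping. -/
def cv : Fin 2 → B k := ![algebraMap (OY k) (B k) (mkY k (X 0)), blowupAlgebra.frac (tr k) 0 1]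

/-- `ψ₀ : k[x, s] → B₂`, `s ↦ ȳ/x̄`. OURS bookkeeping. -/
def ψ₀ : MvPolynomial (Fin 2) k →+* B k :=
  MvPolynomial.eval₂Hom ((algebraMap (OY k) (B k)).comp ((mkY k).comp MvPolynomial.C)) (cv k)

/-- The model equation in `𝒪_{𝒴₂}`: `x̄² = z̄ ȳ²`. [folklore] -/
theorem x_sq : mkY k (X 0) ^ 2 = mkY k (X 2) * mkY k (X 1) ^ 2 := by
  rw [← map_pow, ← map_pow, ← map_mul, Ideal.Quotient.eq]
  have h : (X 0 ^ 2 - X 2 * X 1 ^ 2 : MvPolynomial (Fin 3) k) = rel k := by rw [rel]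
  rw [h]
  exact Ideal.subset_span rfl

/-- `x̄ · (1/x̄) = 1` in `𝒪_{𝒴₂}[1/x̄]`. [folklore] -/
theorem x_mul_invSelf :
    algebraMap (OY k) (Localization.Away (tr k 0)) (tr k 0) * IsLocalization.Away.invSelf (tr k 0) = 1 :=
  IsLocalization.Away.mul_invSelf (S := Localization.Away (tr k 0)) (tr k 0)

/-- `ψ₀` on constants. [folklore] -/
theorem ψ₀_C (a : k) : ψ₀ k (C a) = algebraMap (OY k) (B k) (mkY k (C a)) := MvPolynomial.eval₂Hom_C _ _ a

/-- `ψ₀ x = x̄`. [folklore] -/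
theorem ψ₀_X₀ : ψ₀ k (X 0) = algebraMap (OY k) (B k) (mkY k (X 0)) := MvPolynomial.eval₂Hom_X' _ _ 0

/-- `ψ₀ s = ȳ/x̄`. [folklore] -/
theorem ψ₀_X₁ : ψ₀ k (X 1) = blowupAlgebra.frac (tr k) 0 1 := MvPolynomial.eval₂Hom_X' _ _ 1

/-- **Graph relation `ȳ = x̄ · s` in `B₂`.** [folklore] -/
theorem algebraMap_y_eq : algebraMap (OY k) (B k) (mkY k (X 1)) = ψ₀ k (X 0) * ψ₀ k (X 1) := by
  rw [ψ₀_X₀, ψ₀_X₁]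
  apply Subtype.ext
  rw [Subalgebra.coe_mul, blowupAlgebra.coe_frac]
  exact VertexExit.rel_mul _ _ _ (x_mul_invSelf k)

/-- **Unit relation `z̄ · s² = 1` in `B₂`** (`x² = zy²` divided by `x²`). [folklore] -/
theorem algebraMap_z_mul_sq : algebraMap (OY k) (B k) (mkY k (X 2)) * ψ₀ k (X 1) ^ 2 = 1 := by
  rw [ψ₀_X₁]
  apply Subtype.ext
  rw [Subalgebra.coe_mul, Subalgebra.coe_pow, blowupAlgebra.coe_frac, OneMemClass.coe_one]
  refine rel_unit _ _ _ _ (x_mul_invSelf k) ?_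
  change algebraMap (OY k) (Localization.Away (tr k 0)) (mkY k (X 0)) ^ 2 =
    algebraMap (OY k) _ (mkY k (X 2)) * algebraMap (OY k) _ (mkY k (X 1)) ^ 2
  rw [← map_pow (algebraMap (OY k) (Localization.Away (tr k 0))), ← map_pow (algebraMap (OY k) (Localization.Away (tr k 0))),
    ← map_mul (algebraMap (OY k) (Localization.Away (tr k 0))), x_sq]

/-- `ψ₀ s = ȳ/x̄` is a unit of `B₂`, with inverse `z̄ · s`. [folklore] -/
theorem isUnit_ψ₀_X₁ : IsUnit (ψ₀ k (X 1)) := by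
  refine IsUnit.of_mul_eq_one (algebraMap (OY k) (B k) (mkY k (X 2)) * ψ₀ k (X 1)) ?_
  calc ψ₀ k (X 1) * (algebraMap (OY k) (B k) (mkY k (X 2)) * ψ₀ k (X 1))
        = algebraMap (OY k) (B k) (mkY k (X 2)) * ψ₀ k (X 1) ^ 2 := by ring
    _ = 1 := algebraMap_z_mul_sq k

/-- **`ψ₂ : k[x, s][1/s] → B₂`** (the localisation of `ψ₀` at `s`). OURS bookkeeping. -/
def ψ : Model k →+* B k :=
  IsLocalization.Away.lift (X 1 : MvPolynomial (Fin 2) k) (g := ψ₀ k) (isUnit_ψ₀_X₁ k)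

/-- `ψ₂` extends `ψ₀`. [folklore] -/
theorem ψ_algebraMap (F : MvPolynomial (Fin 2) k) : ψ k (algebraMap _ (Model k) F) = ψ₀ k F :=
  IsLocalization.Away.lift_eq (X 1 : MvPolynomial (Fin 2) k) (isUnit_ψ₀_X₁ k) F

/-! ### `ψ₂` is onto -/

/-- `ψ₀ s · ψ₂ (1/s) = 1`. [folklore] -/
theorem ψ₀_X₁_mul_ψ_invSelf : ψ₀ k (X 1) * ψ k (IsLocalization.Away.invSelf (X 1 : MvPolynomial (Fin 2) k)) = 1 := by
  rw [← ψ_algebraMap, ← map_mul, IsLocalization.Away.mul_invSelf (S := Model k) (X 1 : MvPolynomial (Fin 2) k), map_one]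

/-- `z̄` lies in the image of `ψ₂` (it is `s⁻²`). [folklore] -/
theorem algebraMap_z_mem_range : algebraMap (OY k) (B k) (mkY k (X 2)) ∈ (ψ k).range := by
  refine ⟨IsLocalization.Away.invSelf (X 1 : MvPolynomial (Fin 2) k) ^ 2, ?_⟩
  rw [map_pow]
  calc ψ k (IsLocalization.Away.invSelf (X 1 : MvPolynomial (Fin 2) k)) ^ 2
      = (algebraMap (OY k) (B k) (mkY k (X 2)) * ψ₀ k (X 1) ^ 2) * ψ k (IsLocalization.Away.invSelf (X 1 : MvPolynomial (Fin 2) k)) ^ 2 := by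
          rw [algebraMap_z_mul_sq, one_mul]
    _ = algebraMap (OY k) (B k) (mkY k (X 2)) * (ψ₀ k (X 1) * ψ k (IsLocalization.Away.invSelf (X 1 : MvPolynomial (Fin 2) k))) ^ 2 := by ring
    _ = algebraMap (OY k) (B k) (mkY k (X 2)) := by rw [ψ₀_X₁_mul_ψ_invSelf, one_pow, mul_one]

/-- Every `x̄ⱼ` lies in the image of `ψ₂`. [folklore] -/
theorem algebraMap_X_mem_range (j : Fin 3) : algebraMap (OY k) (B k) (mkY k (X j)) ∈ (ψ k).range := by
  match j with
  | ⟨0, _⟩ =>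
    exact (show algebraMap (OY k) (B k) (mkY k (X 0)) ∈ (ψ k).range from
      ⟨algebraMap (MvPolynomial (Fin 2) k) (Model k) (X 0), by rw [ψ_algebraMap, ψ₀_X₀]⟩)
  | ⟨1, _⟩ =>
    exact (show algebraMap (OY k) (B k) (mkY k (X 1)) ∈ (ψ k).range from
      ⟨algebraMap (MvPolynomial (Fin 2) k) (Model k) (X 0 * X 1), by rw [ψ_algebraMap, map_mul, ← algebraMap_y_eq]⟩)
  | ⟨2, _⟩ => exact algebraMap_z_mem_range k

/-- Every constant lies in the image of `ψ₂`. [folklore] -/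
theorem algebraMap_mem_range (y : OY k) : algebraMap (OY k) (B k) y ∈ (ψ k).range := by
  obtain ⟨G, rfl⟩ := Ideal.Quotient.mk_surjective y
  induction G using MvPolynomial.induction_on with
  | C a => exact ⟨algebraMap (MvPolynomial (Fin 2) k) (Model k) (C a), by rw [ψ_algebraMap, ψ₀_C]⟩
  | add p q hp hq => rw [map_add, map_add]; exact add_mem hp hq
  | mul_X p j hp => rw [map_mul, map_mul]; exact mul_mem hp (algebraMap_X_mem_range k j)

/-- Every fraction lies in the image of `ψ₂`. [folklore] -/
theorem frac_mem_range (j : Fin 2) : blowupAlgebra.frac (tr k) 0 j ∈ (ψ k).range := by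
  match j with
  | ⟨0, _⟩ =>
    refine ⟨1, ?_⟩
    rw [map_one]
    apply Subtype.ext
    rw [blowupAlgebra.coe_frac, OneMemClass.coe_one]
    exact (x_mul_invSelf k).symm
  | ⟨1, _⟩ =>
    exact (show blowupAlgebra.frac (tr k) 0 1 ∈ (ψ k).range from
      ⟨algebraMap (MvPolynomial (Fin 2) k) (Model k) (X 1), by rw [ψ_algebraMap, ψ₀_X₁]⟩)

/-- **`ψ₂` is onto.** [folklore] -/
theorem ψ_surjective : Function.Surjective (ψ k) := by
  intro z
  obtain ⟨F, rfl⟩ := blowupAlgebra.eval_surjective (tr k) 0 z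
  suffices h : (blowupAlgebra.eval (tr k) 0 F) ∈ (ψ k).range by exact h
  induction F using MvPolynomial.induction_on with
  | C y => rw [blowupAlgebra.eval_C]; exact algebraMap_mem_range k y
  | add p q hp hq => rw [map_add]; exact add_mem hp hq
  | mul_X p j hp => rw [map_mul, blowupAlgebra.eval_X]; exact mul_mem hp (frac_mem_range k j.1)

/-! ### `ψ₂` is injective -/

/-- The target of the left inverse: `k[x, s][1/(xs)]`. OURS bookkeeping. -/
abbrev L : Type u := Localization.Away (X 0 * X 1 : MvPolynomial (Fin 2) k)

/-- `1/s = x · 1/(xs)` in `k[x,s][1/(xs)]`. OURS bookkeeping. -/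
def invS : L k := algebraMap (MvPolynomial (Fin 2) k) (L k) (X 0) * IsLocalization.Away.invSelf (X 0 * X 1 : MvPolynomial (Fin 2) k)

/-- `1/x = s · 1/(xs)` in `k[x,s][1/(xs)]`. OURS bookkeeping. -/
def invX : L k := algebraMap (MvPolynomial (Fin 2) k) (L k) (X 1) * IsLocalization.Away.invSelf (X 0 * X 1 : MvPolynomial (Fin 2) k)

/-- `(xs) · 1/(xs) = 1`. [folklore] -/
theorem xs_mul_invSelf : algebraMap (MvPolynomial (Fin 2) k) (L k) (X 0 * X 1) *
    IsLocalization.Away.invSelf (X 0 * X 1 : MvPolynomial (Fin 2) k) = 1 :=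
  IsLocalization.Away.mul_invSelf (S := L k) (X 0 * X 1 : MvPolynomial (Fin 2) k)

/-- `s · (1/s) = 1`. [folklore] -/
theorem s_mul_invS : algebraMap (MvPolynomial (Fin 2) k) (L k) (X 1) * invS k = 1 := by
  rw [invS, ← mul_assoc, ← map_mul, mul_comm (X 1 : MvPolynomial (Fin 2) k), xs_mul_invSelf]

/-- `x · (1/x) = 1`. [folklore] -/
theorem x_mul_invX : algebraMap (MvPolynomial (Fin 2) k) (L k) (X 0) * invX k = 1 := by
  rw [invX, ← mul_assoc, ← map_mul, xs_mul_invSelf]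

/-- The inverse substitution `x ↦ x, y ↦ xs, z ↦ (1/s)²`. OURS bookkeeping. -/
def lamVal : Fin 3 → L k :=
  ![algebraMap (MvPolynomial (Fin 2) k) (L k) (X 0), algebraMap (MvPolynomial (Fin 2) k) (L k) (X 0 * X 1), invS k ^ 2]

/-- `λ(x) = x`. OURS bookkeeping. -/
theorem lamVal_0 : lamVal k 0 = algebraMap (MvPolynomial (Fin 2) k) (L k) (X 0) := rfl

/-- `λ(y) = xs`. OURS bookkeeping. -/
theorem lamVal_1 : lamVal k 1 = algebraMap (MvPolynomial (Fin 2) k) (L k) (X 0 * X 1) := rfl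

/-- `λ(z) = (1/s)²`. OURS bookkeeping. -/
theorem lamVal_2 : lamVal k 2 = invS k ^ 2 := rfl

/-- The substitution kills `x² − z y²`: `x² − (1/s)²(xs)² = 0`. [folklore] -/
theorem span_rel_le_ker :
    Ideal.span {rel k} ≤ RingHom.ker (MvPolynomial.eval₂Hom (algebraMap k (L k)) (lamVal k)) := by
  rw [Ideal.span_le, Set.singleton_subset_iff, SetLike.mem_coe, RingHom.mem_ker, rel]
  simp only [map_sub, map_mul, map_pow, MvPolynomial.eval₂Hom_X', lamVal_0, lamVal_1, lamVal_2]
  have h := s_mul_invS k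
  calc algebraMap (MvPolynomial (Fin 2) k) (L k) (X 0) ^ 2 -
        invS k ^ 2 * (algebraMap (MvPolynomial (Fin 2) k) (L k) (X 0) * algebraMap (MvPolynomial (Fin 2) k) (L k) (X 1)) ^ 2
      = algebraMap (MvPolynomial (Fin 2) k) (L k) (X 0) ^ 2 * (1 - (algebraMap (MvPolynomial (Fin 2) k) (L k) (X 1) * invS k) ^ 2) := by ring
    _ = 0 := by rw [h]; ring

/-- `λ : 𝒪_{𝒴₂} → k[x,s][1/(xs)]`. OURS bookkeeping. -/
def lam : OY k →+* L k :=
  Ideal.Quotient.lift (Ideal.span {rel k}) (MvPolynomial.eval₂Hom (algebraMap k (L k)) (lamVal k))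
    (fun _ ha => RingHom.mem_ker.mp (span_rel_le_ker k ha))

/-- `λ` on classes. [folklore] -/
theorem lam_mkY (F : MvPolynomial (Fin 3) k) :
    lam k (mkY k F) = MvPolynomial.eval₂Hom (algebraMap k (L k)) (lamVal k) F :=
  Ideal.Quotient.lift_mk _ _ _

/-- `λ(x̄) = x`. [folklore] -/
theorem lam_tr_zero : lam k (tr k 0) = algebraMap (MvPolynomial (Fin 2) k) (L k) (X 0) := by
  change lam k (mkY k (X 0)) = _
  rw [lam_mkY, MvPolynomial.eval₂Hom_X', lamVal_0]

/-- `λ(x̄)` is a unit. [folklore] -/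
theorem isUnit_lam_tr_zero : IsUnit (lam k (tr k 0)) := by
  rw [lam_tr_zero]
  exact IsUnit.of_mul_eq_one _ (x_mul_invX k)

/-- **`Λ : 𝒪_{𝒴₂}[1/x̄] → k[x,s][1/(xs)]`**, the left inverse of `ψ₂` after localisation. OURS bookkeeping. -/
def Λ : Localization.Away (tr k 0) →+* L k :=
  IsLocalization.Away.lift (tr k 0) (isUnit_lam_tr_zero k)

/-- `Λ` extends `λ`. [folklore] -/
theorem Λ_algebraMap (y : OY k) : Λ k (algebraMap (OY k) (Localization.Away (tr k 0)) y) = lam k y :=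
  IsLocalization.Away.lift_eq (tr k 0) (isUnit_lam_tr_zero k) y

/-- `Λ` on a fraction `r/x̄`: if `λ r = t · λ x̄` then `Λ (r/x̄) = t`. [folklore] -/
theorem Λ_frac {r : OY k} {t : L k} (h : lam k r = t * lam k (tr k 0)) :
    Λ k (algebraMap (OY k) (Localization.Away (tr k 0)) r * IsLocalization.Away.invSelf (tr k 0)) = t := by
  refine (isUnit_lam_tr_zero k).mul_left_injective ?_
  dsimp only
  rw [← h, ← Λ_algebraMap k (tr k 0), ← map_mul, mul_assoc, mul_comm (IsLocalization.Away.invSelf (tr k 0)),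
    x_mul_invSelf, mul_one, Λ_algebraMap]

/-- The canonical map `ι : k[x,s][1/s] → k[x,s][1/(xs)]`. OURS bookkeeping. -/
def ι : Model k →+* L k :=
  IsLocalization.Away.lift (X 1 : MvPolynomial (Fin 2) k) (g := algebraMap (MvPolynomial (Fin 2) k) (L k))
    (IsUnit.of_mul_eq_one _ (s_mul_invS k))

/-- `ι` extends the structure map. [folklore] -/
theorem ι_algebraMap (F : MvPolynomial (Fin 2) k) : ι k (algebraMap _ (Model k) F) = algebraMap _ (L k) F :=
  IsLocalization.Away.lift_eq (X 1 : MvPolynomial (Fin 2) k) _ F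

/-- **`Λ ∘ ψ₂ = ι`.** [folklore] -/
theorem Λ_comp_ψ : (Λ k).comp (((B k).val : B k →+* Localization.Away (tr k 0)).comp (ψ k)) = ι k := by
  refine IsLocalization.ringHom_ext (Submonoid.powers (X 1 : MvPolynomial (Fin 2) k)) ?_
  refine MvPolynomial.ringHom_ext (fun a => ?_) (fun j => ?_)
  · rw [RingHom.comp_apply, RingHom.comp_apply, RingHom.comp_apply, RingHom.comp_apply, ψ_algebraMap, ψ₀_C, ι_algebraMap]
    change Λ k (algebraMap (OY k) (Localization.Away (tr k 0)) (mkY k (C a))) = _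
    rw [Λ_algebraMap, lam_mkY, MvPolynomial.eval₂Hom_C, IsScalarTower.algebraMap_apply k (MvPolynomial (Fin 2) k) (L k) a,
      MvPolynomial.algebraMap_eq]
  · rw [RingHom.comp_apply, RingHom.comp_apply, RingHom.comp_apply, RingHom.comp_apply, ψ_algebraMap, ι_algebraMap]
    match j with
    | ⟨0, _⟩ =>
      change Λ k ((ψ₀ k (X 0) : B k) : Localization.Away (tr k 0)) = algebraMap _ _ (X 0)
      rw [ψ₀_X₀]
      change Λ k (algebraMap (OY k) (Localization.Away (tr k 0)) (mkY k (X 0))) = _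
      rw [Λ_algebraMap, lam_mkY, MvPolynomial.eval₂Hom_X', lamVal_0]
    | ⟨1, _⟩ =>
      change Λ k ((ψ₀ k (X 1) : B k) : Localization.Away (tr k 0)) = algebraMap _ _ (X 1)
      rw [ψ₀_X₁, blowupAlgebra.coe_frac]
      refine Λ_frac k ?_
      change lam k (mkY k (X 1)) = _
      rw [lam_tr_zero, lam_mkY, MvPolynomial.eval₂Hom_X', lamVal_1, map_mul, mul_comm]

/-- `ι` is injective (`k` a domain): `k[x,s][1/s] → k[x,s][1/(xs)]` is a localisation of a domain. [folklore] -/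
theorem ι_injective [IsDomain k] : Function.Injective (ι k) := by
  intro a b hab
  obtain ⟨⟨a₀, ya⟩, rfl⟩ := IsLocalization.mk'_surjective (Submonoid.powers (X 1 : MvPolynomial (Fin 2) k)) a
  obtain ⟨⟨b₀, yb⟩, rfl⟩ := IsLocalization.mk'_surjective (Submonoid.powers (X 1 : MvPolynomial (Fin 2) k)) b
  dsimp only at hab ⊢
  have hinjL : Function.Injective (algebraMap (MvPolynomial (Fin 2) k) (L k)) :=
    IsLocalization.injective _ (powers_le_nonZeroDivisors_of_noZeroDivisors
      (mul_ne_zero (MvPolynomial.X_ne_zero 0) (MvPolynomial.X_ne_zero 1)))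
  have key : ∀ (c : MvPolynomial (Fin 2) k) (y : Submonoid.powers (X 1 : MvPolynomial (Fin 2) k)),
      ι k (IsLocalization.mk' (Model k) c y) * algebraMap (MvPolynomial (Fin 2) k) (L k) (y : MvPolynomial (Fin 2) k) =
        algebraMap (MvPolynomial (Fin 2) k) (L k) c := by
    intro c y
    have h2 := congrArg (ι k) (IsLocalization.mk'_spec (Model k) c y)
    rwa [map_mul, ι_algebraMap, ι_algebraMap] at h2
  have ha := key a₀ ya
  have hb := key b₀ yb
  rw [hab] at ha
  have h3 : algebraMap (MvPolynomial (Fin 2) k) (L k) (↑ya * b₀) = algebraMap (MvPolynomial (Fin 2) k) (L k) (↑yb * a₀) := by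
    rw [map_mul, map_mul, ← ha, ← hb]; ring
  exact IsLocalization.mk'_eq_of_eq (hinjL h3)

/-- **`ψ₂` is injective** (`k` a domain). [folklore] -/
theorem ψ_injective [IsDomain k] : Function.Injective (ψ k) := by
  have hinj : Function.Injective (ι k) := ι_injective k
  rw [← Λ_comp_ψ, RingHom.coe_comp, RingHom.coe_comp] at hinj
  exact hinj.of_comp.of_comp

/-! ### Conclusion -/

/-- **PINCH CHART (model form): `ψ₂ : k[x, s][1/s] → B₂ = 𝒪_{𝒴₂}[(x̄,ȳ)/x̄]` is a bijection** — the chart `x̄ ≠ 0` of the blow-up of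
the Whitney umbrella `{x² = zy²}` along its double line `(x̄, ȳ)` is the localised plane `Spec k[x, s, s⁻¹]`, the graph
`ȳ = x̄ s`, `z̄ = s⁻²`. OURS. -/
theorem ψ_bijective [IsDomain k] : Function.Bijective (ψ k) :=
  ⟨ψ_injective k, ψ_surjective k⟩

/-- **The pinch chart `B₂` is a regular ring** (over a field) — THEOREM A (2.7), pinch points, chart `x̄`; the chart `ȳ` is
✓ `PhaseBFinish.isRegularRing_B` after renaming. OURS. -/
theorem isRegularRing_B (K : Type u) [Field K] : IsRegularRing (B K) :=
  haveI : IsRegularRing (Model K) := isRegularRing_localization (Submonoid.powers (X 1 : MvPolynomial (Fin 2) K))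
  IsRegularRing.of_ringEquiv (RingEquiv.ofBijective (ψ K) (ψ_bijective K))

end PinchChart

end Summit.ResolutionOfSingularities.ResolutionOfSingularities.Cruxes.EquisingularLiftNat.Sections
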